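import Mathlib

/-!
# (B3-c) COUPLING CONDITIONS for three-term monads `0 → 𝒜 → 𝒩 → 𝒞 → 0` on `X = (E×E)⁴` — kernel + spec

hsemireg-monad-4 g8 (planner-hsemireg-monad-4-g8-0), 2026-08-30.  D-0145 token:
`line stmt-HodgeConjecture-18881 Cruxes/BlochSeedDiscOne/Lines/birth.lean 814a6a70c14e831a stub_rung_pad4_seedAt`.
Companion memo: `Cruxes/BlochSeedDiscOne/B3C-COUPLING-monad4-g8.md`; engine `b3couple.py`.

CENSUS-NEUTRAL.  Nothing in this file is a rung or a step toward HC / HC_CM / HC_AV / №4 / 26512 / 18881 / H2.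
A letter design ≠ a monad ≠ a sheaf ≠ a SEED.  This file is evidence + a typed spec: Mathlib-only, no `sorry`,
no new axioms, no `instance`, no `notation`, no banned options.  Machine tables (the engine) ≠ kernel.

## What is here
* §1 KERNEL (fully proved linear algebra):
  - `sumMap`, `sumMap_apply`, `sumMap_single`, `range_sumMap`, `finrank_ker_sumMap_add`, `rado_codim` —
    the RADO CODIMENSION LEMMA behind THEOREM C of the memo: for subspaces `W i ≤ V` and nonzero weights `c i`
    the map `(Π i, W i) → V, w ↦ Σ cᵢ • wᵢ` has range `⨆ W i`, hence `dim ker + dim (⨆ W i) = Σ dim W i`, so the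
    weight-tuples summing to zero have codimension `dim (⨆ W i) ≥ |J| + t` inside `Π W i`.
  - `rank_add_syzygies_le`, `rank_le_of_syzygies` — the SYZYGY FLOOR (B3-c)₁ in linear-algebra form: an
    `m`-dimensional space of syzygies of `M_α(q) : Hom(L_α,𝒩) → Hom(L_α,𝒞)` forces `rank M_α(q) ≤ D_α - m`.
* §2 SPEC (letter-level predicates on ℕ/ℤ data produced by the engine; Bool-valued so that rows are `decide`d):
  `CellFloor` (`m, D, T`), `naiveSyz`, `floorOK`, `expCodim`, `theoremCApplicable`, `effOrZeroNecEE`, and the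
  S16a rows of the memo's TABLE checked by `decide` / `norm_num`.
* §3 PEN (this docstring): the statements the spec abbreviates.  Setting: uniform symmetric labelling of a LINE
  design (letter `(a,x,y)` on factor `S_j = E×E`, `E : y² = x³ - x`; level `β = h - a`, ray `ζ ∈ {Δ, Δ⁻, Γ_i, Γ₋ᵢ}`;
  `L(ζ,β) = 𝒪(Θ)^(h-2β) ⊗ 𝒪(C_ζ)^β`, hub `= 𝒪(Θ)^h`).
  LEMMA 1 (blocks).  `Hom(L(ζ,β), L(ζ',β'))` on one factor is `ℂ` if `(ζ,β) = (ζ',β')` or `β = β' = 0`; is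
  `H⁰(S, 𝒪((β-β')C_{-ζ})) = φ_{-ζ}^* H⁰(B, 𝒪((β-β')·o))` (dimension `β-β'`) if `β > β'` and (`ζ' = ζ` or `β' = 0`);
  and is `0` otherwise (`2Θ ∼ C_ζ + C_{-ζ}` by seesaw; `φ_{-ζ} : S → B = S/C_{-ζ}` has connected fibres).
  LEMMA 2 (ray coherence).  Along a live path `α → ν → γ` every factor uses one ray map `φ_{-ζ_j(α)}` or scalars,
  so `M_α(q) : Hom(L_α,𝒩) → Hom(L_α,𝒞)`, `s ↦ q ∘ s`, is block-multiplication of one-variable Riemann–Roch spaces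
  `L(k·o) = ⟨xᵃyᵇ : 2a+3b ≤ k, b ≤ 1⟩` with structure constants in `{0, ±1}` (`y² = x³ - x`): EXACT linear algebra.
  (B3-c)₁ SYZYGY FLOOR (necessary, exact).  For the monad's own `q`: `σ_α(q) := dim ker M_α(q) =
  h⁰(𝓗om(L_α, ker q)) ≥ m_α` for every A-cell `α` (the `m_α` columns of `i` are independent syzygies).  Always
  `σ_α(q) = D_α - rank M_α(q) ≥ (D_α - T_α)⁺`, with equality off a proper closed cone when the generic rank is
  `min(D_α,T_α)` (the engine decides this per cell).  Dually (B3-c)₁^∨ COSYZYGY FLOOR for the monad's own `i`: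
  `dim {r ∈ Hom(𝒩, L_γ) : r ∘ i = 0} ≥ m_γ` for every C-cell `γ`.
  (B3-c)₂ THEOREM C (sufficient).  `q` onto at every point, `K = ker q` (rank `κ = n - c`), `I_α(x) := ev_x Syz_α(q)
  ⊂ K(x)`, Rado surplus `s(x) := min_{∅≠T⊆A-cells} (dim Σ_{α∈T} I_α(x) - m(T))`.  If `s ≥ dim Σ` on every stratum
  `Σ` of a finite stratification of `X` (so `s ≥ 8` on the open stratum), then for general `i ∈ Π_α Syz_α(q)^{m_α}`
  the display is a monad with `E = K / i(𝒜)` locally free of rank `r = n - a - c` and `c(E) = c(𝒩)c(𝒜)⁻¹c(𝒞)⁻¹`.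
  Proof: incidence `Bad ⊂ Σ × Π Syz`; by RADO (a family of `m(T)` vectors drawn from the `I_α(x)` can be chosen
  independent iff `dim Σ_T I_α(x) ≥ m(T)` for all `T`) and `rado_codim` the fibre of `Bad` over `x` has codimension
  `≥ 1 + s(x)`; sum over strata.  THEOREM C needs `r ≥ 8` and the copy-level shadow margin `|U(T)| - m(T) ≥ 9` for
  all `T` (`U(T)` = N-copies live from `T`), since `Σ_T I_α(x) ⊂ ker(q(x)|U(T)) ⊂ ℂ^{U(T)}`.
  (B3-c)₃ FUNCTION-FIELD CLOSURE LAW (necessary).  For every set `U` of N-copies, `a(U)` := A-mass whose shadow lies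
  in `U`: `rank_{k(X)} (q|_U) ≤ |U| - a(U)` and `rank q(x)|_U ≤ |U| - a(U)` at every `x` where `i(x)` is injective.
  (B3-c)₄ SHADOW-DETERMINANT ROW (necessary).  `𝒩_A` := N-copies live from ≥ 1 A-cell (mass `n_A`), `𝒩_f := 𝒩/𝒩_A`
  (mass `f`), `ρ_A := rank_{k(X)} q|_{𝒩_A}`, `δ := c₁(𝒜) + c₁(𝒞) - c₁(𝒩_A) = c₁(𝒩_f) - c₁(E)`.  If `f = r` then
  EITHER `ρ_A ≤ c - 1` OR (`ρ_A = c`, the kernel `(K ∩ 𝒩_A)/i(𝒜)` of `E → 𝒩_f` is a rank-0 subsheaf of the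
  torsion-free `E`, hence `0`, so `E ↪ 𝒩_f` with `det ≠ 0` and) `δ` is EFFECTIVE, `δ = 0` forcing `E ≅ 𝒩_f` split.
  S16a: `f = r = 16`, `δ = -56·(I₁+I₂+I₃+I₄)`, `δ·H⁷ < 0` ⇒ every monad on S16a has `ρ_A ≤ 32 < c = 33`.
-/

set_option linter.dupNamespace false
set_option linter.unusedSectionVars false

namespace Summit.HodgeConjecture.HodgeConjecture.Cruxes.BlochSeedDiscOne.B3Coupling

open Module

/-! ## §1 Kernel: the Rado codimension lemma and the syzygy floor (linear algebra over a field) -/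

section Kernel

variable {K : Type*} [Field K] {V : Type*} [AddCommGroup V] [Module K V]
variable {ι : Type*} [Fintype ι] [DecidableEq ι]

/-- The weighted sum map `(Π i, W i) →ₗ[K] V`, `w ↦ Σ i, c i • (w i : V)`. -/
def sumMap (W : ι → Submodule K V) (c : ι → K) : (Π i, W i) →ₗ[K] V :=
  ∑ i, c i • ((W i).subtype ∘ₗ LinearMap.proj i)

theorem sumMap_apply (W : ι → Submodule K V) (c : ι → K) (w : Π i, W i) :
    sumMap W c w = ∑ i, c i • (w i : V) := by
  simp [sumMap, LinearMap.sum_apply]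

theorem sumMap_single (W : ι → Submodule K V) (c : ι → K) (j : ι) (x : W j) :
    sumMap W c (Pi.single j x) = c j • (x : V) := by
  rw [sumMap_apply, Finset.sum_eq_single j]
  · simp
  · intro i _ hij
    simp [Pi.single_eq_of_ne hij]
  · intro h
    exact absurd (Finset.mem_univ j) h

/-- The range of the weighted sum map with nonzero weights is the sum of the subspaces. -/
theorem range_sumMap (W : ι → Submodule K V) (c : ι → K) (hc : ∀ i, c i ≠ 0) :
    LinearMap.range (sumMap W c) = ⨆ i, W i := by
  apply le_antisymm
  · rintro v ⟨w, rfl⟩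
    rw [sumMap_apply]
    exact Submodule.sum_mem _ fun i _ =>
      Submodule.smul_mem _ _ (Submodule.mem_iSup_of_mem i (w i).2)
  · refine iSup_le fun j => ?_
    intro x hx
    refine ⟨Pi.single j ⟨(c j)⁻¹ • x, Submodule.smul_mem _ _ hx⟩, ?_⟩
    rw [sumMap_single]
    simp [smul_smul, mul_inv_cancel₀ (hc j)]

variable [FiniteDimensional K V]

/-- Rank–nullity for the weighted sum map: `dim ker + dim (⨆ W i) = Σ dim (W i)`. -/
theorem finrank_ker_sumMap_add (W : ι → Submodule K V) (c : ι → K) (hc : ∀ i, c i ≠ 0) :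
    finrank K (LinearMap.ker (sumMap W c)) + finrank K (⨆ i, W i : Submodule K V)
      = ∑ i, finrank K (W i) := by
  rw [← range_sumMap W c hc, add_comm, LinearMap.finrank_range_add_finrank_ker]
  exact Module.finrank_pi_fintype (R := K)

/-- RADO CODIMENSION LEMMA (arithmetic form).  If the subspaces indexed by `J = ι` span at least `|J| + t`
dimensions, the weight-tuples `w ∈ Π W i` with `Σ cᵢ wᵢ = 0` have codimension at least `|J| + t`. -/
theorem rado_codim (W : ι → Submodule K V) (c : ι → K) (hc : ∀ i, c i ≠ 0) (t : ℕ)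
    (h : Fintype.card ι + t ≤ finrank K (⨆ i, W i : Submodule K V)) :
    finrank K (LinearMap.ker (sumMap W c)) + (Fintype.card ι + t) ≤ ∑ i, finrank K (W i) := by
  have := finrank_ker_sumMap_add W c hc
  omega

/-- SYZYGY FLOOR, linear-algebra form: a space `S` of syzygies of `M` costs `M` that much rank. -/
theorem rank_add_syzygies_le {W₂ : Type*} [AddCommGroup W₂] [Module K W₂]
    (M : V →ₗ[K] W₂) (S : Submodule K V) (hS : S ≤ LinearMap.ker M) :
    finrank K (LinearMap.range M) + finrank K S ≤ finrank K V := by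
  have h1 := LinearMap.finrank_range_add_finrank_ker M
  have h2 := Submodule.finrank_mono hS
  omega

/-- (B3-c)₁ as a forced rank drop: `m` independent syzygies force `rank M ≤ dim V - m`. -/
theorem rank_le_of_syzygies {W₂ : Type*} [AddCommGroup W₂] [Module K W₂]
    (M : V →ₗ[K] W₂) (S : Submodule K V) (hS : S ≤ LinearMap.ker M) (m : ℕ)
    (hm : m ≤ finrank K S) :
    finrank K (LinearMap.range M) ≤ finrank K V - m := by
  have := rank_add_syzygies_le M S hS
  omega

end Kernel

/-! ## §2 Spec: letter-level rows as decidable predicates (data = engine output) -/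

section Spec

/-- Letter-level data of one A-cell `α` (dually of one C-cell `γ`): multiplicity `m`,
`D = dim Hom(L_α, 𝒩)`, `T = dim Hom(L_α, 𝒞)` — sums over live N-copies (resp. C-copies) of the products over the four
factors of the Mumford `h⁰` table (LEMMA 1). -/
structure CellFloor where
  m : ℕ
  D : ℕ
  T : ℕ

/-- naive generic syzygy number `(D - T)⁺` (truncated subtraction). -/
def CellFloor.naiveSyz (c : CellFloor) : ℕ := c.D - c.T

/-- (B3-c)₁ at generic `q` (no structural rank drop): the floor `(D - T)⁺ ≥ m`. -/
def CellFloor.floorOK (c : CellFloor) : Bool := decide (c.m ≤ c.naiveSyz)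

/-- expected codimension `m·(T - D + m)⁺` of `{q : σ_α(q) ≥ m}` in `Hom(𝒩,𝒞)` (determinantal count; an upper
bound for the true codimension of that cone, no claim of equality). -/
def CellFloor.expCodim (c : CellFloor) : ℕ := c.m * (c.T + c.m - c.D)

/-- rank drop that the monad's `q` must exhibit on `M_α` relative to the generic rank `min(D,T)`. -/
def CellFloor.requiredDrop (c : CellFloor) : ℕ := min c.D c.T + c.m - c.D

/-- THEOREM C regime: rank `r ≥ 8 = dim X` and copy-level shadow margin `min_T (|U(T)| - m(T)) ≥ 9`. -/
def theoremCApplicable (r marginMin : ℕ) : Bool := decide (8 ≤ r) && decide (9 ≤ marginMin)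

/-- NECESSARY numerical test for a class `aI + xe + yf ≠ 0` on `S = E×E` (letters `⟨I,e,f⟩`, Gram `diag(2,-2,-2)`)
to be effective: `D·H > 0` and `D² ≥ 0`, i.e. `0 < a ∧ x² + y² ≤ a²`; the zero class passes.  Used only in the
direction "test fails ⇒ not effective" (row (B3-c)₄). -/
def effOrZeroNecEE (a x y : ℤ) : Bool :=
  (a == 0 && x == 0 && y == 0) || (decide (0 < a) && decide (x * x + y * y ≤ a * a))

/-! ### The S16a rows of the TABLE (design `design-S16a.json` sha16 afce949837878586; 16 cells per profile) -/

/-- A-cell profiles of S16a: single-ray levels 4,5,6,7 and mixed `(2,2,2,1)`; `(m, D_α, T_α)` from the engine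
(`T_α = 33·dim L(β)`-products against the 33 hub copies). -/
def s16aA : List CellFloor := [⟨1, 18, 132⟩, ⟨1, 26, 165⟩, ⟨1, 33, 198⟩, ⟨1, 41, 231⟩, ⟨1, 88, 264⟩]

/- every S16a A-cell FAILS the generic-q floor (the engine confirms `σ_α = 0`, rank `= D_α`, at generic `q`). -/
example : s16aA.all (fun c => !c.floorOK) = true := by decide

/- required rank drops `1` on each `M_α` (generic rank `D_α`, needed `≤ D_α - 1`). -/
example : s16aA.map CellFloor.requiredDrop = [1, 1, 1, 1, 1] := by decide

/- expected-codimension budget of S16a: `16·Σ expCodim = 12624 > 12177 = dim Hom(𝒩,𝒞) = 33·369`. -/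
example : 16 * (s16aA.map CellFloor.expCodim).sum = 12624 := by decide
example : 33 * 369 = 12177 := by decide

/- the C-side (cosyzygy) row of S16a: hub `m = 33`, `D' = 369`, `T' = 480`: floor fails at generic `i`. -/
example : (CellFloor.floorOK ⟨33, 369, 480⟩) = false := by decide

/- THEOREM C is inapplicable to S16a by counting: `r = 16 ≥ 8` but the chain shadow margin is `8 - 4 = 4 < 9`;
and to the three MINT rank-4 designs (`r = 4 < 8`). -/
example : theoremCApplicable 16 4 = false := by decide
example : theoremCApplicable 4 0 = false := by decide

/- row (B3-c)₄ on S16a: per factor `c₁(𝒜)_j = 1004`, `c₁(𝒞)_j = 33·14 = 462`, `c₁(𝒩_A)_j = 1522`, so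
`δ_j = -56` (coefficient of `I_j`; the `e_j, f_j` coefficients vanish by ray symmetry): not effective. -/
example : (4 * (10 + 9 + 8 + 7) + 3 * 16 * 14 + (12 * 12 + 4 * 13) : ℤ) = 1004 := by norm_num
example : (4 * (9 + 2 * 11 + 4 * 13) + 3 * 28 * 14 + 14 : ℤ) = 1522 := by norm_num
example : (1004 : ℤ) + 33 * 14 - 1522 = -56 := by norm_num
example : effOrZeroNecEE (-56) 0 0 = false := by decide

end Spec

end Summit.HodgeConjecture.HodgeConjecture.Cruxes.BlochSeedDiscOne.B3Coupling
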